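import Summits.Ventures.Crystal3D.Theorems.StickyWulffConstantPolycrystalWulffBoundFibreChimera

/-!
# Chimera Brunn–Minkowski with RUNS: a height-dependent summand whose section profiles are NOT
# pointwise comparable, coupled run by run through quantile slabs (engine for CHARGED twin walls,
# line `PolyDensity`, crux `stmt-Ventures-19482`)

Route `StickyWulffConstant` of the venture `Summits/Ventures/Crystal3D`, second prover lane (poly-p2,
gen 8).  The charge-free engines (`chimera3_brunnMinkowski`, `chimera3_fibre_brunnMinkowski`) need the
bodies' sections (fibres) to dominate ONE reference.  For inclined twin lamellae the two bodies `W`,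
`R_m W` have different section-area profiles along the wall normal; the remedy (seat memo P-TWIN-g8 §1,
«n-first with a rearrangement») is to cut the height axis into RUNS `I_i` (the lamellae), give each run
its own body `W_i` and its own QUANTILE SLAB `J_i` of that body carrying the same mass fraction `θ_i`,
apply the section chimera inequality run by run, and sum:
* `chimera3_runs_volume_rpow_mul_le` — `Σ_i |A ∩ {a₂ ∈ I_i}|^{1−s} |W_i ∩ {w₂ ∈ J_i}|^s ≤ Σ_i |C ∩ {c₂ ∈ Z_i}|`
  whenever `Z_i ⊇ (1−s)I_i + sJ_i` and `C ∋ (1−s)a + s w` for `a ∈ A` over `I_i`, `w ∈ W_i` over `J_i`;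
* `chimera3_runs_pow` — homogeneous form: `(a+b)³ ≤ Σ_i |C ∩ {c₂ ∈ Z_i}|` for `Z_i ⊇ I_i + J_i`,
  `θ_i a³ ≤ |A ∩ {I_i}|`, `θ_i b³ ≤ |W_i ∩ {J_i}|`, `Σ θ_i = 1`.
The right-hand side exceeds `|C|` only by the volume of `C` over the OVERLAPS of consecutive windows
`Z_i ∩ Z_{i+1}`, whose heights are the quantile mismatches of consecutive bodies at the switch levels — the
wall charge of the method (`r·|τ₊ − τ₋|·section`).  Pure measure theory; the application is elsewhere.
WHAT THIS IS NOT: a statement about lattices, perimeters or textures; the crux is not claimed.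
-/

noncomputable section

namespace Summit.Ventures.Crystal3D.Theorems.Chimera

open MeasureTheory Set
open scoped ENNReal Pointwise

/-- Height slabs `{x | x 2 ∈ I}` are measurable for measurable `I`. -/
theorem measurableSet_heightSlab {I : Set ℝ} (hI : MeasurableSet I) :
    MeasurableSet {x : Fin 3 → ℝ | x 2 ∈ I} :=
  hI.preimage (measurable_pi_apply 2)

/-- Dilating a height slab: `c • (S ∩ {x₂ ∈ I}) = (c • S) ∩ {x₂ ∈ c • I}` for `c ≠ 0`. -/
theorem smul_inter_heightSlab {c : ℝ} (hc : c ≠ 0) (S : Set (Fin 3 → ℝ)) (I : Set ℝ) :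
    c • (S ∩ {x : Fin 3 → ℝ | x 2 ∈ I}) = (c • S) ∩ {x : Fin 3 → ℝ | x 2 ∈ c • I} := by
  ext x
  rw [Set.mem_smul_set_iff_inv_smul_mem₀ hc, mem_inter_iff, mem_inter_iff,
    Set.mem_smul_set_iff_inv_smul_mem₀ hc, mem_setOf_eq, mem_setOf_eq,
    Set.mem_smul_set_iff_inv_smul_mem₀ hc]
  simp [smul_eq_mul]

/-- **Chimera Brunn–Minkowski with runs, multiplicative form.**  For runs `I_i` (heights of `A`), bodies
`W_i` with quantile slabs `J_i`, and windows `Z_i ⊇ (1−s)I_i + sJ_i`: if `C ∋ (1−s)a + s w` whenever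
`a ∈ A`, `a₂ ∈ I_i`, `w ∈ W_i`, `w₂ ∈ J_i`, then
`Σ_i |A ∩ {I_i}|^{1−s}·|W_i ∩ {J_i}|^s ≤ Σ_i |C ∩ {Z_i}|`. -/
theorem chimera3_runs_volume_rpow_mul_le {s : ℝ} (hs0 : 0 < s) (hs1 : s < 1) {N : ℕ}
    {A C : Set (Fin 3 → ℝ)} (I J Z : Fin N → Set ℝ) (W : Fin N → Set (Fin 3 → ℝ))
    (hA : MeasurableSet A) (hC : MeasurableSet C) (hW : ∀ i, MeasurableSet (W i))
    (hI : ∀ i, MeasurableSet (I i)) (hJ : ∀ i, MeasurableSet (J i)) (hZ : ∀ i, MeasurableSet (Z i))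
    (hIJZ : ∀ i, (1 - s) • I i + s • J i ⊆ Z i)
    (hsub : ∀ i, ∀ a ∈ A, a 2 ∈ I i → ∀ w ∈ W i, w 2 ∈ J i → (1 - s) • a + s • w ∈ C) :
    ∑ i, volume (A ∩ {x : Fin 3 → ℝ | x 2 ∈ I i}) ^ (1 - s) *
        volume (W i ∩ {x : Fin 3 → ℝ | x 2 ∈ J i}) ^ s ≤
      ∑ i, volume (C ∩ {x : Fin 3 → ℝ | x 2 ∈ Z i}) := by
  refine Finset.sum_le_sum fun i _ => ?_
  refine chimera3_volume_rpow_mul_le hs0 hs1 (fun _ => W i ∩ {x : Fin 3 → ℝ | x 2 ∈ J i})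
    (hA.inter (measurableSet_heightSlab (hI i))) (hC.inter (measurableSet_heightSlab (hZ i)))
    ((hW i).inter (measurableSet_heightSlab (hJ i)))
    (fun _ => (hW i).inter (measurableSet_heightSlab (hJ i))) (fun _ _ => le_rfl) ?_
  rintro a ⟨ha, haI⟩ w ⟨hw, hwJ⟩
  refine ⟨hsub i a ha haI w hw hwJ, ?_⟩
  show ((1 - s) • a + s • w) 2 ∈ Z i
  have : ((1 - s) • a + s • w) 2 = (1 - s) • a 2 + s • w 2 := by simp [smul_eq_mul]
  rw [this]
  exact hIJZ i (Set.add_mem_add (Set.smul_mem_smul_set haI) (Set.smul_mem_smul_set hwJ))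

/-- **Chimera Brunn–Minkowski with runs, homogeneous form.**  With mass fractions `θ_i ≥ 0`,
`Σ θ_i = 1`, `θ_i a³ ≤ |A ∩ {I_i}|`, `θ_i b³ ≤ |W_i ∩ {J_i}|` (`a, b > 0`), windows `Z_i ⊇ I_i + J_i` and
`C ∋ x + w` for `x ∈ A` over `I_i`, `w ∈ W_i` over `J_i`:  `(a + b)³ ≤ Σ_i |C ∩ {Z_i}|`. -/
theorem chimera3_runs_pow {N : ℕ} {A C : Set (Fin 3 → ℝ)} (I J Z : Fin N → Set ℝ)
    (W : Fin N → Set (Fin 3 → ℝ))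
    (hA : MeasurableSet A) (hC : MeasurableSet C) (hW : ∀ i, MeasurableSet (W i))
    (hI : ∀ i, MeasurableSet (I i)) (hJ : ∀ i, MeasurableSet (J i)) (hZ : ∀ i, MeasurableSet (Z i))
    (hIJZ : ∀ i, I i + J i ⊆ Z i)
    (hsub : ∀ i, ∀ x ∈ A, x 2 ∈ I i → ∀ w ∈ W i, w 2 ∈ J i → x + w ∈ C)
    (θ : Fin N → ℝ) (hθ0 : ∀ i, 0 ≤ θ i) (hθ1 : ∑ i, θ i = 1)
    {a b : ℝ} (ha : 0 < a) (hb : 0 < b)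
    (hvA : ∀ i, ENNReal.ofReal (θ i * a ^ 3) ≤ volume (A ∩ {x : Fin 3 → ℝ | x 2 ∈ I i}))
    (hvW : ∀ i, ENNReal.ofReal (θ i * b ^ 3) ≤ volume (W i ∩ {x : Fin 3 → ℝ | x 2 ∈ J i})) :
    ENNReal.ofReal ((a + b) ^ 3) ≤ ∑ i, volume (C ∩ {x : Fin 3 → ℝ | x 2 ∈ Z i}) := by
  have hab : 0 < a + b := add_pos ha hb
  set s : ℝ := b / (a + b) with hs
  have hs0 : 0 < s := div_pos hb hab
  have hs1 : s < 1 := (div_lt_one hab).2 (by linarith)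
  have h1s : 1 - s = a / (a + b) := by rw [hs]; field_simp; ring
  -- scaled data
  have hmult := chimera3_runs_volume_rpow_mul_le hs0 hs1 (A := a⁻¹ • A) (C := (a + b)⁻¹ • C)
    (fun i => a⁻¹ • I i) (fun i => b⁻¹ • J i) (fun i => (a + b)⁻¹ • Z i) (fun i => b⁻¹ • W i)
    (hA.const_smul₀ a⁻¹) (hC.const_smul₀ (a + b)⁻¹) (fun i => (hW i).const_smul₀ b⁻¹)
    (fun i => (hI i).const_smul₀ a⁻¹) (fun i => (hJ i).const_smul₀ b⁻¹)
    (fun i => (hZ i).const_smul₀ (a + b)⁻¹)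
    (by
      intro i z hz
      obtain ⟨_, ⟨_, ⟨t, ht, rfl⟩, rfl⟩, _, ⟨_, ⟨u, hu, rfl⟩, rfl⟩, rfl⟩ := hz
      refine Set.mem_smul_set.2 ⟨t + u, hIJZ i (Set.add_mem_add ht hu), ?_⟩
      simp only [smul_eq_mul]
      rw [h1s, hs]
      field_simp)
    (by
      intro i x hx hxI w hw hwJ
      obtain ⟨x', hx', rfl⟩ := Set.mem_smul_set.1 hx
      obtain ⟨w', hw', rfl⟩ := Set.mem_smul_set.1 hw
      have hxI' : x' 2 ∈ I i := by
        have := (Set.mem_smul_set_iff_inv_smul_mem₀ (inv_ne_zero ha.ne') _ _).1 hxI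
        simpa [smul_eq_mul, ← mul_assoc, mul_inv_cancel₀ ha.ne'] using this
      have hwJ' : w' 2 ∈ J i := by
        have := (Set.mem_smul_set_iff_inv_smul_mem₀ (inv_ne_zero hb.ne') _ _).1 hwJ
        simpa [smul_eq_mul, ← mul_assoc, mul_inv_cancel₀ hb.ne'] using this
      refine Set.mem_smul_set.2 ⟨x' + w', hsub i x' hx' hxI' w' hw' hwJ', ?_⟩
      rw [h1s, hs, smul_smul, smul_smul, div_mul_eq_mul_div, mul_inv_cancel₀ ha.ne',
        div_mul_eq_mul_div, mul_inv_cancel₀ hb.ne', one_div, smul_add])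
  -- left-hand side: each run contributes at least `θ_i`
  have hL : ∀ i, ENNReal.ofReal (θ i) ≤
      volume ((a⁻¹ • A) ∩ {x : Fin 3 → ℝ | x 2 ∈ a⁻¹ • I i}) ^ (1 - s) *
        volume ((b⁻¹ • W i) ∩ {x : Fin 3 → ℝ | x 2 ∈ b⁻¹ • J i}) ^ s := by
    intro i
    have hvA' : ENNReal.ofReal (θ i) ≤ volume ((a⁻¹ • A) ∩ {x : Fin 3 → ℝ | x 2 ∈ a⁻¹ • I i}) := by
      rw [← smul_inter_heightSlab (inv_ne_zero ha.ne'), volume_smul_fin3, abs_of_pos (inv_pos.2 ha)]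
      calc ENNReal.ofReal (θ i) = ENNReal.ofReal (a⁻¹ ^ 3) * ENNReal.ofReal (θ i * a ^ 3) := by
            rw [← ENNReal.ofReal_mul (pow_nonneg (inv_pos.2 ha).le _)]
            congr 1; field_simp
        _ ≤ _ := by gcongr; exact hvA i
    have hvW' : ENNReal.ofReal (θ i) ≤ volume ((b⁻¹ • W i) ∩ {x : Fin 3 → ℝ | x 2 ∈ b⁻¹ • J i}) := by
      rw [← smul_inter_heightSlab (inv_ne_zero hb.ne'), volume_smul_fin3, abs_of_pos (inv_pos.2 hb)]
      calc ENNReal.ofReal (θ i) = ENNReal.ofReal (b⁻¹ ^ 3) * ENNReal.ofReal (θ i * b ^ 3) := by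
            rw [← ENNReal.ofReal_mul (pow_nonneg (inv_pos.2 hb).le _)]
            congr 1; field_simp
        _ ≤ _ := by gcongr; exact hvW i
    calc ENNReal.ofReal (θ i) = ENNReal.ofReal (θ i) ^ (1 - s) * ENNReal.ofReal (θ i) ^ s := by
          rw [← ENNReal.rpow_add_of_nonneg _ _ (by linarith) hs0.le]
          norm_num
      _ ≤ _ := mul_le_mul' (ENNReal.rpow_le_rpow hvA' (by linarith)) (ENNReal.rpow_le_rpow hvW' hs0.le)
  have hone : (1 : ℝ≥0∞) ≤ ∑ i, volume (((a + b)⁻¹ • C) ∩ {x : Fin 3 → ℝ | x 2 ∈ (a + b)⁻¹ • Z i}) := by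
    calc (1 : ℝ≥0∞) = ENNReal.ofReal (∑ i, θ i) := by rw [hθ1, ENNReal.ofReal_one]
      _ = ∑ i, ENNReal.ofReal (θ i) := ENNReal.ofReal_sum_of_nonneg fun i _ => hθ0 i
      _ ≤ _ := Finset.sum_le_sum fun i _ => hL i
      _ ≤ _ := hmult
  -- undo the scaling of `C`
  have hscale : ∀ i, volume (((a + b)⁻¹ • C) ∩ {x : Fin 3 → ℝ | x 2 ∈ (a + b)⁻¹ • Z i}) =
      ENNReal.ofReal ((a + b)⁻¹ ^ 3) * volume (C ∩ {x : Fin 3 → ℝ | x 2 ∈ Z i}) := by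
    intro i
    rw [← smul_inter_heightSlab (inv_ne_zero hab.ne'), volume_smul_fin3, abs_of_pos (inv_pos.2 hab)]
  simp_rw [hscale, ← Finset.mul_sum] at hone
  calc ENNReal.ofReal ((a + b) ^ 3) = ENNReal.ofReal ((a + b) ^ 3) * 1 := (mul_one _).symm
    _ ≤ ENNReal.ofReal ((a + b) ^ 3) * (ENNReal.ofReal ((a + b)⁻¹ ^ 3) *
          ∑ i, volume (C ∩ {x : Fin 3 → ℝ | x 2 ∈ Z i})) := by gcongr
    _ = ∑ i, volume (C ∩ {x : Fin 3 → ℝ | x 2 ∈ Z i}) := by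
        rw [← mul_assoc, ← ENNReal.ofReal_mul (pow_nonneg hab.le _), ← mul_pow,
          mul_inv_cancel₀ hab.ne', one_pow, ENNReal.ofReal_one, one_mul]

/-! ### Bookkeeping of consecutive window overlaps -/

/-- **Consecutive-overlap bookkeeping.**  If the measurable sets `S 0, …, S k` meet only consecutively
(`S i ∩ S j = ∅` for `i + 2 ≤ j`), then
`Σ_{i ≤ k} μ (S i) ≤ μ (⋃_{i ≤ k} S i) + Σ_{i < k} μ (S i ∩ S (i+1))`. -/
theorem sum_measure_le_measure_biUnion_add_consecutive {α : Type*} [MeasurableSpace α]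
    (μ : Measure α) (S : ℕ → Set α) (hS : ∀ i, MeasurableSet (S i))
    (hdisj : ∀ i j, i + 2 ≤ j → S i ∩ S j = ∅) (k : ℕ) :
    ∑ i ∈ Finset.range (k + 1), μ (S i) ≤
      μ (⋃ i ∈ Finset.range (k + 1), S i) + ∑ i ∈ Finset.range k, μ (S i ∩ S (i + 1)) := by
  induction k with
  | zero => simp
  | succ k ih =>
    rw [Finset.sum_range_succ (fun i => μ (S i)) (k + 1),
      Finset.sum_range_succ (fun i => μ (S i ∩ S (i + 1))) k]
    have hU : MeasurableSet (⋃ i ∈ Finset.range (k + 1), S i) :=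
      MeasurableSet.biUnion (Finset.range (k + 1)).countable_toSet fun i _ => hS i
    -- inclusion–exclusion for the new set
    have hsplit : (⋃ i ∈ Finset.range (k + 1 + 1), S i) = (⋃ i ∈ Finset.range (k + 1), S i) ∪ S (k + 1) := by
      rw [Finset.range_add_one, Finset.set_biUnion_insert, union_comm]
    have hIE : μ ((⋃ i ∈ Finset.range (k + 1), S i) ∪ S (k + 1)) +
        μ ((⋃ i ∈ Finset.range (k + 1), S i) ∩ S (k + 1)) =
        μ (⋃ i ∈ Finset.range (k + 1), S i) + μ (S (k + 1)) :=
      measure_union_add_inter _ (hS (k + 1))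
    -- only `S k` can meet `S (k+1)`
    have hinter : (⋃ i ∈ Finset.range (k + 1), S i) ∩ S (k + 1) ⊆ S k ∩ S (k + 1) := by
      rintro x ⟨hx, hxk⟩
      simp only [mem_iUnion, Finset.mem_range, exists_prop] at hx
      obtain ⟨i, hi, hxi⟩ := hx
      by_cases hik : i + 2 ≤ k + 1
      · have h0 := hdisj i (k + 1) hik
        have : x ∈ S i ∩ S (k + 1) := ⟨hxi, hxk⟩
        rw [h0] at this
        exact absurd this (notMem_empty x)
      · have : i = k := by omega
        subst this
        exact ⟨hxi, hxk⟩
    have hbound : μ ((⋃ i ∈ Finset.range (k + 1), S i) ∩ S (k + 1)) ≤ μ (S k ∩ S (k + 1)) :=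
      measure_mono hinter
    rw [hsplit]
    calc ∑ i ∈ Finset.range (k + 1), μ (S i) + μ (S (k + 1))
        ≤ μ (⋃ i ∈ Finset.range (k + 1), S i) + ∑ i ∈ Finset.range k, μ (S i ∩ S (i + 1)) +
            μ (S (k + 1)) := by gcongr
      _ = (μ (⋃ i ∈ Finset.range (k + 1), S i) + μ (S (k + 1))) +
            ∑ i ∈ Finset.range k, μ (S i ∩ S (i + 1)) := by ring
      _ = μ ((⋃ i ∈ Finset.range (k + 1), S i) ∪ S (k + 1)) +
            μ ((⋃ i ∈ Finset.range (k + 1), S i) ∩ S (k + 1)) +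
            ∑ i ∈ Finset.range k, μ (S i ∩ S (i + 1)) := by rw [hIE]
      _ ≤ μ ((⋃ i ∈ Finset.range (k + 1), S i) ∪ S (k + 1)) + μ (S k ∩ S (k + 1)) +
            ∑ i ∈ Finset.range k, μ (S i ∩ S (i + 1)) := by gcongr
      _ = μ ((⋃ i ∈ Finset.range (k + 1), S i) ∪ S (k + 1)) +
            (∑ i ∈ Finset.range k, μ (S i ∩ S (i + 1)) + μ (S k ∩ S (k + 1))) := by ring

end Summit.Ventures.Crystal3D.Theorems.Chimera

end
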